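import Literature.Analysis.FluidPDE.ChaeEulerTypeIThresholdHolds
import Literature.Analysis.FluidPDE.TaoSpeedContinuation
import Literature.Analysis.FluidPDE.ClassicalSolutionGlue
import Literature.Analysis.FluidPDE.AncientLPSLiouvilleProofs
import HarnessLib

/-!
# Fluid computer — the level dictionary, EULER FACE (E1–E2): the Euler controls of the cell have two necessities of
# their own — Beale–Kato–Majda and Chae's Type-I threshold with the EXPLICIT constant `1`

HONEST FRAMING (cell `pub-fluidc`, verbatim): *low prior, high value-of-information experiment on Tao's
machine paradigm; NOT a claim that NS blows up.* Theorem side of the cell; nothing here is evidence of blow-up.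
Every row L1–L50 carries a positive power of `ν`: the dictionary said nothing about the cell's EULER controls. Two
criteria PROVED in the tree apply at `ν = 0`: Beale–Kato–Majda (1984, Thm. 1; `beale_kato_majda_holds`, stated for
`ν ≥ 0`) and Chae's Type-I threshold (J. Funct. Anal. 258 (2010), Thm. 1.1; `chae2010_euler_typeI_threshold_holds`:
if `limsup_{t↑T} (T − t)‖∇u(t)‖_∞ < 1` the vorticity is transported with an integrable bound and BKM continues the
solution). The class: MAXIMAL classical Euler solutions on `ℝ³ × [0, T)` (`IsMaximalSmoothSolution 0 0 u p T`, the
tree's `IsClassicalEulerSolutionOn = IsClassicalNSSolutionOn … 0 …`) in the Beale–Kato–Majda class on every closed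
sub-slab (`HasBoundedSobolevNormsOn (Icc 0 T'') u`, `T'' < T` — all Sobolev norms bounded; for Navier–Stokes this
class hypothesis was discharged in gen 15, for Euler it is carried):

* `euler_bkm_window` (**E1 — BKM ON EVERY TERMINAL WINDOW**): `∫_{(t₀,T)} sup_x ‖curl u(t, x)‖ dt = ∞` for every
  `t₀ ∈ [0, T)`;
* `euler_typeI_threshold` (**E2 — CHAE'S THRESHOLD, CONSTANT ONE**): for every `M₀ < 1` and every `t₀ ∈ [0, T)`
  some `t ∈ [t₀, T)` and `x` have `M₀ < (T − t)·‖∇u(t, x)‖` — `limsup_{t↑T} (T − t)‖∇u(t)‖_∞ ≥ 1`;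
* `euler_face`: both assembled.

Reading for the machine paradigm (words AND one number): an inviscid design that blows up at `T` must have
`(T − t)·max_x |∇u(t, x)|` reaching above EVERY level below `1` arbitrarily close to `T` — a scale-invariant
diagnostic with an explicit absolute threshold, unlike every viscous row; and the running `∫ max|ω|` must diverge.
Class = `ℝ³`, `H^∞` solutions (the cell's periodic Euler runs are analogies). Necessity only. 0 sorry; no new
definitions, no named facts.

## References

* J. T. Beale, T. Kato, A. Majda, Comm. Math. Phys. 94 (1984) 61–66, Thm. 1. [BealeKatoMajda1984]
* D. Chae, J. Funct. Anal. 258 (2010) 2865–2883 (arXiv:0711.1113), Thm. 1.1. [Chae2010]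
* A. J. Majda, A. L. Bertozzi, *Vorticity and Incompressible Flow*, CUP 2002, Thm. 3.6. [MajdaBertozziCUP2002]
-/

noncomputable section

open MeasureTheory Set Function Filter Topology Metric
open scoped ENNReal NNReal
open Literature.Analysis.FluidPDE Literature.Analysis.FunctionSpaces

namespace Summit.NavierStokesRegularity.FluidComputer.EulerFace

/-! ## E1: Beale–Kato–Majda on every terminal window -/

/-- **E1 — BKM for maximal Euler solutions, whole life**: for a maximal classical Euler solution `(u, p)` on
`ℝ³ × [0, T)` (`T > 0`) in the BKM class on every closed sub-slab, `∫_{(0,T)} sup_x ‖curl u(t, x)‖ dt = ∞`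
(`beale_kato_majda_holds` at `ν = 0`, against maximality). [cite: BealeKatoMajda1984, Thm. 1]
[cite: MajdaBertozziCUP2002, Thm. 3.6] -/
theorem euler_bkm {T : ℝ} (hT : 0 < T)
    {u : ℝ → EuclideanSpace ℝ (Fin 3) → EuclideanSpace ℝ (Fin 3)} {p : ℝ → EuclideanSpace ℝ (Fin 3) → ℝ}
    (hmax : IsMaximalSmoothSolution 0 0 u p T) (hreg : ∀ T'' < T, HasBoundedSobolevNormsOn (Icc 0 T'') u) :
    (∫⁻ t in Ioo 0 T, ⨆ x, ‖curl (u t) x‖ₑ) = ∞ := by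
  by_contra hne
  have hlt : (∫⁻ t in Ioo 0 T, ⨆ x, ‖curl (u t) x‖ₑ) < ∞ := lt_top_iff_ne_top.2 hne
  have hext : HasSobolevExtensionPast 0 u T := (beale_kato_majda_holds le_rfl hT hmax.1 hreg).2 hlt
  exact hmax.2 hext.hasSmoothExtensionPast

/-- **E1 — BKM ON EVERY TERMINAL WINDOW**: with the same data, for every `t₀ ∈ [0, T)`:
`∫_{(t₀,T)} sup_x ‖curl u(t, x)‖ dt = ∞` (translate at `s = (t₀+T)/2`: the translate is a maximal Euler solution,
`IsMaximalSmoothSolution.translate_zero`, in the BKM class by `HasBoundedSobolevNormsOn.comp_add_right`; translate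
the time integral back). [cite: BealeKatoMajda1984, Thm. 1] -/
theorem euler_bkm_window {T : ℝ} (hT : 0 < T)
    {u : ℝ → EuclideanSpace ℝ (Fin 3) → EuclideanSpace ℝ (Fin 3)} {p : ℝ → EuclideanSpace ℝ (Fin 3) → ℝ}
    (hmax : IsMaximalSmoothSolution 0 0 u p T) (hreg : ∀ T'' < T, HasBoundedSobolevNormsOn (Icc 0 T'') u)
    {t₀ : ℝ} (ht₀ : t₀ ∈ Ico 0 T) :
    (∫⁻ t in Ioo t₀ T, ⨆ x, ‖curl (u t) x‖ₑ) = ∞ := by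
  set s : ℝ := (t₀ + T) / 2 with hsdef
  have hs : s ∈ Ioo 0 T := ⟨by rw [hsdef]; linarith [ht₀.1, ht₀.2], by rw [hsdef]; linarith [ht₀.2]⟩
  have ht₀s : t₀ < s := by rw [hsdef]; linarith [ht₀.2]
  have hTs : 0 < T - s := sub_pos.2 hs.2
  have hmaxs : IsMaximalSmoothSolution 0 0 (fun t => u (t + s)) (fun t => p (t + s)) (T - s) :=
    hmax.translate_zero hs.1 hs.2
  have hregs : ∀ T'' < T - s, HasBoundedSobolevNormsOn (Icc 0 T'') (fun t => u (t + s)) := by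
    intro T'' hT''
    refine HasBoundedSobolevNormsOn.comp_add_right s ((hreg (T'' + s) (by linarith)).mono ?_)
    intro t ht
    exact ⟨by linarith [ht.1, hs.1], ht.2⟩
  have key := euler_bkm hTs hmaxs hregs
  set F : ℝ → ℝ≥0∞ := fun t => ⨆ x, ‖curl (u t) x‖ₑ with hF
  have hshift : (∫⁻ t in Ioo 0 (T - s), F (t + s)) = ∫⁻ t in Ioo s T, F t := by
    rw [lintegral_Ioo_comp_add_right F s (T - s), add_sub_cancel]
  have hmono : (∫⁻ t in Ioo s T, F t) ≤ ∫⁻ t in Ioo t₀ T, F t :=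
    lintegral_mono_set (Ioo_subset_Ioo_left ht₀s.le)
  have hkey' : (∫⁻ t in Ioo 0 (T - s), F (t + s)) = ⊤ := key
  rw [hshift] at hkey'
  exact eq_top_iff.2 (hkey' ▸ hmono)

/-! ## E2: Chae's Type-I threshold with constant one -/

/-- **E2 — CHAE'S TYPE-I THRESHOLD (constant `1`).** For a maximal classical Euler solution `(u, p)` on
`ℝ³ × [0, T)` (`T > 0`) in the BKM class on every closed sub-slab, for every `M₀ < 1` and every `t₀ ∈ [0, T)` there
are `t ∈ [t₀, T)` and `x` with `M₀ < (T − t)·‖∇u(t, x)‖` (`∇u = fderiv`, operator norm): the scale-invariant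
quantity `(T − t)‖∇u(t)‖_∞` has `limsup ≥ 1` at a genuine blow-up (`chae2010_euler_typeI_threshold_holds`, against
maximality). [cite: Chae2010, Thm 1.1 (= arXiv:0711.1113 Thm 1.1)] -/
theorem euler_typeI_threshold {T : ℝ} (hT : 0 < T)
    {u : ℝ → EuclideanSpace ℝ (Fin 3) → EuclideanSpace ℝ (Fin 3)} {p : ℝ → EuclideanSpace ℝ (Fin 3) → ℝ}
    (hmax : IsMaximalSmoothSolution 0 0 u p T) (hreg : ∀ T'' < T, HasBoundedSobolevNormsOn (Icc 0 T'') u)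
    {M₀ : ℝ} (hM₀ : M₀ < 1) {t₀ : ℝ} (ht₀ : t₀ ∈ Ico 0 T) :
    ∃ t ∈ Ico t₀ T, ∃ x : EuclideanSpace ℝ (Fin 3), M₀ < (T - t) * ‖fderiv ℝ (u t) x‖ := by
  by_contra hno
  push Not at hno
  have hext : HasSobolevExtensionPast 0 u T :=
    chae2010_euler_typeI_threshold_holds hT hmax.1 hreg ⟨M₀, hM₀, t₀, ht₀, hno⟩
  exact hmax.2 hext.hasSmoothExtensionPast

/-- **THE EULER FACE, ASSEMBLED**: a maximal classical Euler solution in the BKM class on closed sub-slabs has, on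
every terminal window, a divergent BKM integral and `(T − t)‖∇u‖_∞` exceeding every `M₀ < 1` somewhere.
[cite: BealeKatoMajda1984, Thm. 1] [cite: Chae2010, Thm 1.1] -/
theorem euler_face {T : ℝ} (hT : 0 < T)
    {u : ℝ → EuclideanSpace ℝ (Fin 3) → EuclideanSpace ℝ (Fin 3)} {p : ℝ → EuclideanSpace ℝ (Fin 3) → ℝ}
    (hmax : IsMaximalSmoothSolution 0 0 u p T) (hreg : ∀ T'' < T, HasBoundedSobolevNormsOn (Icc 0 T'') u) :
    (∀ t₀ ∈ Ico 0 T, (∫⁻ t in Ioo t₀ T, ⨆ x, ‖curl (u t) x‖ₑ) = ∞) ∧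
      ∀ M₀ : ℝ, M₀ < 1 → ∀ t₀ ∈ Ico 0 T,
        ∃ t ∈ Ico t₀ T, ∃ x : EuclideanSpace ℝ (Fin 3), M₀ < (T - t) * ‖fderiv ℝ (u t) x‖ :=
  ⟨fun _ ht₀ => euler_bkm_window hT hmax hreg ht₀, fun _ hM₀ _ ht₀ => euler_typeI_threshold hT hmax hreg hM₀ ht₀⟩

end Summit.NavierStokesRegularity.FluidComputer.EulerFace

end
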